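import Mathlib
import HarnessLib
import Summits.HubbardSuperconductivity.HubbardSuperconductivity.Theorems.KLProgrammeKLRegimeEngineAnisoLineFromPlainWt
import Summits.HubbardSuperconductivity.HubbardSuperconductivity.Theorems.KLProgrammeKLRegimeOverlapWtJumpFlowAll
import Summits.HubbardSuperconductivity.HubbardSuperconductivity.Theorems.KLProgrammeKLRegimeEngineThinCount2Doors

/-!
# Route `KLProgramme` — crux K3 ENGINE (stmt-HubbardSuperconductivity-20437 `KLRegimeEngineV17F2`), stub (b) conjunct `KernelNormsWt4` / the weighted tower's imports:
# THE WEIGHTED SINGLE-MULTIPLIER CHARACTER SUM ON THE FLOW FRAME, AND THE WEIGHTED TWO-, FOUR- AND SIX-LEG ONE-ANCHOR IMPORTS FROM WEIGHTED PLAIN LINES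
# (cell gate-hubbard-kl, seat hubbard-kl-k3c2-p3 g15, row «sector-counting import», located «(ℓ)-IMPORT-WT» (W1)/(W4); register item «(b)-WT4», pen (R355))

`…EngineAnisoLineFromPlainWt` (this seat) is the model-generic weighted transfer: `klWtPinnedSumAt … J j (m+1) T q (y, ℓ) ≤ N_c · (T₁/(βL²))^{m+1}·ε^{m+1}·Sʷ` for a
momentum-conserving `T`, from (i) a rate-`j` weighted character-sum bound `T₁` of the single multipliers `F_{J,ω}`, (ii) a one-anchor count `N_c` of
`bgmSectorSet (F_J) (m+1)`, (iii) a bound `Sʷ` on the `klScaleWt_j`-weighted PLAIN pinned sums.  Here the inputs (i) and (ii) are DISCHARGED in the KL regime on the flow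
frame `K_n = klFlowFrameU … n`:

* §1 **`charSumWt_klAniso_single_flow_all (R c″)`** — `∃ CT > 0`: under the binders of `charSumWt_nbPair_klEng_flow_all` (p4/k3c3 lineage: `R.WF2`, `0 < cc ≤ klEngC₃6`,
  `μ ∈ klWindowC`, `0 < U ≤ min (klEngU₀3 P R cc) (1/(Gfr₃+1))`, `c″U ≤ 1`, `klBetaMin ≤ β ≤ e^{cc/U²}`, `klEngL₃`, `klEngM₃`, `1 ≤ n ≤ n_β+1`, `IsKLRegime`, `HistP`,
  osc pieces), for every `1 ≤ J ≤ n`, every rate `j ≥ J` and every `ω`: the rate-`j` weighted character sum of `F_{J,ω}[K_n]` is `≤ CT·M·L²` (pairs `(J, J−1)` at the finer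
  weight `Λ_J ≥ Λ_j`, telescoped over the ≤ 27 coarse partners by `charSumWt_klAniso_single_le`); so `(T₁/(βL²))·ε = CT/2` — M, L, β-free;
* §2 **`klWtPinnedSumAt_le_of_wplain_flow_all (m) (R c″)`** — `∃ CW > 0`: same binders, `1 ≤ J ≤ n`, `J ≤ j`, momentum-conserving `T`, one-anchor count `≤ N_c`,
  weighted plain pinned sums `≤ Sʷ` ⇒ `klWtPinnedSumAt … J j (m+1) T q (y, ℓ) ≤ N_c·CW^{m+1}·Sʷ` (`CW = CT/2`);
* §3 the counts put in: **`klWtPinnedSumAt_two_le_of_wplain_flow_all`** (`N_c = klThinCount2C`, p694657), **`klWtPinnedSumAt_four_le_of_wplain_flow_all`**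
  (`N_c = klThinCountC·sectorCount J`, p4's `card_bgmSectorSet_klAniso_anchored_le_doors`), **`klWtPinnedSumAt_six_le_of_wplain_flow_all`**
  (`N_c = klThinCount6C·|SectorLeg (sectorCount J)|⁴`, p689804) — each under its count doors, for every momentum-conserving `T` (so for the tower input `𝒱_{dk}[K_n]`
  at `J = dk − 1` and for `𝒱_j[K_n]` at `J = j`, the `KernelNormsWt4` carrier `klWtPinnedSum = klWtPinnedSumAt … j j`).
Everything is proved; no definitions; the weighted plain lines stay hypotheses (E1); nothing asserts (ℓ), `KernelNormsWt4`, any stub, K3 or superconductivity.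
References: BGM 2006 §2.7 (2.66), (2.70)–(2.71a), §2.8 (2.76)–(2.77), (2.82)–(2.84) [cite: BenfattoGiulianiMastropietro2006].
-/

noncomputable section

namespace Summit.HubbardSuperconductivity.HubbardSuperconductivity.Theorems.EngineV8

set_option linter.dupNamespace false -- summit = problem name (single-conjunct summit), D-0017

open Classical
open Real Finset Literature.MathematicalPhysics.QuantumLattice Literature.Probability.LatticeModels GrassmannAlgebra
open Literature.MathematicalPhysics.QuantumLattice.FermiRG
open Summit.HubbardSuperconductivity.HubbardSuperconductivity.Theorems.KLProgrammeLegKernels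
open Summit.HubbardSuperconductivity.HubbardSuperconductivity.Theorems.KLRegimeSplit
open Summit.HubbardSuperconductivity.HubbardSuperconductivity.Theorems.TorusFourierL2
open Summit.HubbardSuperconductivity.HubbardSuperconductivity.Theorems.DispersionFlow
open Summit.HubbardSuperconductivity.HubbardSuperconductivity.Theorems.KLRegimeWick

/-! ## §1 The weighted single-multiplier character sum on the flow frame -/

/-- **THE RATE-`j` WEIGHTED CHARACTER SUM OF ONE THIN MULTIPLIER ON THE FLOW FRAME** (`1 ≤ J ≤ n`, `J ≤ j`): `∃ CT > 0` with
`Σ_z (1 + Λ_j·β/(2M)·|z₀| + Λ_j|z₁| + Λ_j|z₂|)·‖Σ_q χ_q(z) F_{J,ω}[K_n](k_q)‖ ≤ CT·M·L²` under the binders of `charSumWt_nbPair_klEng_flow_all` — the neighbouring pair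
`(J, J−1)` at its own weight scale `Λ_J ≥ Λ_j`, telescoped over the ≤ 27 coarse partners. [cite: BenfattoGiulianiMastropietro2006, §2.7 (2.66), (2.71a)] -/
theorem charSumWt_klAniso_single_flow_all (R : RenConsts) (c'' : ℝ) (hc'' : 0 ≤ c'') :
    ∃ CT : ℝ, 0 < CT ∧
      ∀ (G : GeoConsts) (P : SplitConsts) (Q : EngConsts) (cc : ℝ), R.WF2 → 0 < cc → cc ≤ klEngC₃6 P R →
      ∀ μ ∈ klWindowC, ∀ U : ℝ, 0 < U → U ≤ min (klEngU₀3 P R cc) (1 / (R.Gfr 3 + 1)) → c'' * U ≤ 1 →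
      ∀ β : ℝ, klBetaMin ≤ β → β ≤ Real.exp (cc / U ^ 2) →
      ∀ (L M : ℕ) [NeZero L] [NeZero M], klEngL₃ β U ≤ L → klEngM₃ β U L ≤ M →
      ∀ n : ℕ, 1 ≤ n → n ≤ nScales β + 1 → IsKLRegime U cc (-(n : ℤ)) → HistP klPredsV17F2 L M G P Q R β U μ 0 n →
        (∀ m, 1 ≤ m → m < n → FlowPieceOscAt L M c'' β U μ m) →
        ∀ J j : ℕ, 1 ≤ J → J ≤ n → J ≤ j → ∀ ω : Fin (sectorCount J),
        ∑ z : TorusSite 1 (2 * M) × TorusSite 2 L,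
          (1 + klScale klE0 j * β / (2 * M) * |(((z.1 0).valMinAbs : ℤ) : ℝ)| + klScale klE0 j * |(((z.2 0).valMinAbs : ℤ) : ℝ)| +
              klScale klE0 j * |(((z.2 1).valMinAbs : ℤ) : ℝ)|) *
          ‖∑ q : TorusSite 1 (2 * M) × TorusSite 2 L, (torusChar q.1 z.1 * torusChar q.2 z.2) •
            klAnisoFamily L M β μ (klFlowFrameU L M β U μ n) klE0 J ω (⟨(q.1 0).val, ZMod.val_lt (q.1 0)⟩, q.2)‖ ≤ CT * M * (L : ℝ) ^ 2 := by
  obtain ⟨CT, hCT, h⟩ := charSumWt_nbPair_klEng_flow_all R c'' hc''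
  refine ⟨27 * CT, by positivity, ?_⟩
  intro G P Q cc hR2 hcc hcc6 μ hμ U hU hUle hcU β hβmin hβc L M _ _ hL3 hM3 n hn1 hnN hreg hhist hosc J j hJ1 hJn hJj ω
  have hβ0 : 0 < β := KLRegimeSplit.pos_of_klBetaMin_le hβmin
  have hM0 : (0 : ℝ) < M := Nat.cast_pos.2 (Nat.pos_of_ne_zero (NeZero.ne M))
  obtain ⟨J₀, rfl⟩ : ∃ J₀, J = J₀ + 1 := ⟨J - 1, by omega⟩
  set K : TrigPolyC4v := klFlowFrameU L M β U μ n with hKdef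
  have hT0 : 0 ≤ CT * M * (L : ℝ) ^ 2 := by positivity
  have hΛ0 : 0 ≤ klScale klE0 j := (klth_klScale_pos j).le
  have hβM : 0 ≤ β / (2 * M) := by positivity
  -- the pairs `(J, J−1)` at the weight scale `Λ_j ≤ Λ_J`
  have hT : ∀ a' : Fin (sectorCount (J₀ + 1 - 1)), ∑ z : TorusSite 1 (2 * M) × TorusSite 2 L,
      (1 + klScale klE0 j * β / (2 * M) * |(((z.1 0).valMinAbs : ℤ) : ℝ)| + klScale klE0 j * |(((z.2 0).valMinAbs : ℤ) : ℝ)| +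
          klScale klE0 j * |(((z.2 1).valMinAbs : ℤ) : ℝ)|) *
      ‖∑ q : TorusSite 1 (2 * M) × TorusSite 2 L, (torusChar q.1 z.1 * torusChar q.2 z.2) •
        (klAnisoFamily L M β μ K klE0 (J₀ + 1) ω (⟨(q.1 0).val, ZMod.val_lt (q.1 0)⟩, q.2) *
          klAnisoFamily L M β μ K klE0 (J₀ + 1 - 1) a' (⟨(q.1 0).val, ZMod.val_lt (q.1 0)⟩, q.2))‖ ≤ CT * M * (L : ℝ) ^ 2 := by
    intro a'
    have hbd := h G P Q cc hR2 hcc hcc6 μ hμ U hU hUle hcU β hβmin hβc L M hL3 hM3 n hn1 hnN hreg hhist hosc J₀ (by omega) ω a'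
    refine le_trans (sum_le_sum fun z _ => mul_le_mul_of_nonneg_right ?_ (norm_nonneg _)) hbd
    have hΛle : klScale klE0 j ≤ klScale klE0 (J₀ + 1) := klScale_le_klScale (by norm_num [klE0]) hJj
    have h0 : 0 ≤ |(((z.1 0).valMinAbs : ℤ) : ℝ)| := abs_nonneg _
    have h1 : 0 ≤ |(((z.2 0).valMinAbs : ℤ) : ℝ)| := abs_nonneg _
    have h2 : 0 ≤ |(((z.2 1).valMinAbs : ℤ) : ℝ)| := abs_nonneg _
    have ht : klScale klE0 j * β / (2 * M) ≤ klScale klE0 (J₀ + 1) * β / (2 * M) := by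
      rw [mul_div_assoc, mul_div_assoc]; exact mul_le_mul_of_nonneg_right hΛle hβM
    gcongr
  have hs := charSumWt_klAniso_single_le (L := L) (M := M) β μ K (a := klScale klE0 j * β / (2 * M)) (b := klScale klE0 j)
    (by positivity) hΛ0 (n := J₀ + 1) (by omega) ω hT0 hT
  linarith [hs]

/-! ## §2 The weighted one-anchor size from the weighted plain line, transfer discharged -/

/-- **WEIGHTED ONE-ANCHOR SIZE FROM THE WEIGHTED PLAIN LINE ON THE FLOW FRAME** (leg count `m + 1`): `∃ CW > 0` (`= CT/2`) such that, under the binders of §1, for every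
`1 ≤ J ≤ n`, rate `j ≥ J`, momentum-conserving `T`, pinned leg `q`, pin `(y, ℓ)`, one-anchor count `N_c` of `bgmSectorSet (F_J[K_n]) (m+1)` at `(q, ℓ)` and bound `Sʷ ≥ 0`
of the `klScaleWt_j`-weighted PLAIN pinned sums of `T` at leg `q`: `klWtPinnedSumAt L M β μ K_n J j (m+1) T q (y, ℓ) ≤ N_c·CW^{m+1}·Sʷ`.
[cite: BenfattoGiulianiMastropietro2006, §2.7 (2.71a), §2.8 (2.76)-(2.77)] -/
theorem klWtPinnedSumAt_le_of_wplain_flow_all (m : ℕ) (R : RenConsts) (c'' : ℝ) (hc'' : 0 ≤ c'') :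
    ∃ CW : ℝ, 0 < CW ∧
      ∀ (G : GeoConsts) (P : SplitConsts) (Q : EngConsts) (cc : ℝ), R.WF2 → 0 < cc → cc ≤ klEngC₃6 P R →
      ∀ μ ∈ klWindowC, ∀ U : ℝ, 0 < U → U ≤ min (klEngU₀3 P R cc) (1 / (R.Gfr 3 + 1)) → c'' * U ≤ 1 →
      ∀ β : ℝ, klBetaMin ≤ β → β ≤ Real.exp (cc / U ^ 2) →
      ∀ (L M : ℕ) [NeZero L] [NeZero M], klEngL₃ β U ≤ L → klEngM₃ β U L ≤ M →
      ∀ n : ℕ, 1 ≤ n → n ≤ nScales β + 1 → IsKLRegime U cc (-(n : ℤ)) → HistP klPredsV17F2 L M G P Q R β U μ 0 n →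
        (∀ m', 1 ≤ m' → m' < n → FlowPieceOscAt L M c'' β U μ m') →
        ∀ J j : ℕ, 1 ≤ J → J ≤ n → J ≤ j → ∀ T : HubbardGrassmann L M,
        (∀ (m' : ℕ) (X : Fin m' → HubbardFieldIdx L M), ∑ i, signedMomentum L (X i).2 (X i).1.1.2 ≠ 0 → kernel ℂ T m' X = 0) →
        ∀ (q : Fin (m + 1)) (y : SpaceTimeIdx L M) (ℓ : SectorLeg (sectorCount J)) (Nc Sw : ℝ), 0 ≤ Sw →
        ((((bgmSectorSet L M (klAnisoFamily L M β μ (klFlowFrameU L M β U μ n) klE0 J) (m + 1)).filter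
            (fun σ : Fin (m + 1) → SectorLeg (sectorCount J) => σ q = ℓ)).card : ℕ) : ℝ) ≤ Nc →
        (∀ (τ' : Fin (m + 1) → SectorLeg 1) (y' : SpaceTimeIdx L M),
          imagTimeWeight β M ^ m * ∑ x' ∈ univ.filter (fun x' : Fin (m + 1) → SpaceTimeIdx L M => x' q = y'),
            klScaleWt L M β j ((univ.image x').image (fun x : SpaceTimeIdx L M => (((((2 * (x.1 : ℕ) : ℕ)) : ZMod (2 * (2 * M)))), x.2))) *
              ‖sectorisedKernel L M β (trivialMultiplier L M) T (m + 1) τ' x'‖ ≤ Sw) →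
        klWtPinnedSumAt L M β μ (klFlowFrameU L M β U μ n) J j (m + 1) T q (y, ℓ) ≤ Nc * (CW ^ (m + 1) * Sw) := by
  obtain ⟨CT, hCT, h⟩ := charSumWt_klAniso_single_flow_all R c'' hc''
  refine ⟨CT / 2, by positivity, ?_⟩
  intro G P Q cc hR2 hcc hcc6 μ hμ U hU hUle hcU β hβmin hβc L M _ _ hL3 hM3 n hn1 hnN hreg hhist hosc J j hJ1 hJn hJj T hT q y ℓ Nc Sw hSw
    hcount hplain
  have hβ0 : 0 < β := KLRegimeSplit.pos_of_klBetaMin_le hβmin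
  have hM0 : (0 : ℝ) < M := Nat.cast_pos.2 (Nat.pos_of_ne_zero (NeZero.ne M))
  have hL0 : (0 : ℝ) < L := Nat.cast_pos.2 (Nat.pos_of_ne_zero (NeZero.ne L))
  have hT0 : 0 ≤ CT * M * (L : ℝ) ^ 2 := by positivity
  have hs := klWtPinnedSumAt_le_count_mul_of_wplain hβ0 μ (klFlowFrameU L M β U μ n) J j m T hT hT0
    (fun ω => h G P Q cc hR2 hcc hcc6 μ hμ U hU hUle hcU β hβmin hβc L M hL3 hM3 n hn1 hnN hreg hhist hosc J j hJ1 hJn hJj ω)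
    q y ℓ hSw hcount hplain
  have hval : (CT * M * (L : ℝ) ^ 2 / (β * (L : ℝ) ^ 2)) ^ m * (CT * M * (L : ℝ) ^ 2 / (β * (L : ℝ) ^ 2)) *
      imagTimeWeight β M ^ (m + 1) = (CT / 2) ^ (m + 1) := by
    have hq : CT * M * (L : ℝ) ^ 2 / (β * (L : ℝ) ^ 2) * imagTimeWeight β M = CT / 2 := by
      unfold imagTimeWeight
      field_simp
    rw [← pow_succ, ← mul_pow, hq]
  rw [hval] at hs
  exact hs

/-! ## §3 The counts put in: two, four and six legs -/

/-- **THE WEIGHTED TWO-LEG ONE-ANCHOR SIZE FROM THE WEIGHTED PLAIN LINE** (`N_c = klThinCount2C`, doors `cc ≤ klThinCount2C₃ R`, `U ≤ klThinCount2U₀ R`): `∃ CW > 0`,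
binders of §2 at `m + 1 = 2` plus the two count doors ⇒ `klWtPinnedSumAt … J j 2 T q (y, ℓ) ≤ klThinCount2C·CW²·Sʷ`.
[cite: BenfattoGiulianiMastropietro2006, §2.8 (2.76)-(2.77)] -/
theorem klWtPinnedSumAt_two_le_of_wplain_flow_all (R : RenConsts) (c'' : ℝ) (hc'' : 0 ≤ c'') :
    ∃ CW : ℝ, 0 < CW ∧
      ∀ (G : GeoConsts) (P : SplitConsts) (Q : EngConsts) (cc : ℝ), R.WF2 → 0 < cc → cc ≤ klEngC₃6 P R → cc ≤ klThinCount2C₃ R →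
      ∀ μ ∈ klWindowC, ∀ U : ℝ, 0 < U → U ≤ min (klEngU₀3 P R cc) (1 / (R.Gfr 3 + 1)) → U ≤ klThinCount2U₀ R → c'' * U ≤ 1 →
      ∀ β : ℝ, klBetaMin ≤ β → β ≤ Real.exp (cc / U ^ 2) →
      ∀ (L M : ℕ) [NeZero L] [NeZero M], klEngL₃ β U ≤ L → klEngM₃ β U L ≤ M →
      ∀ n : ℕ, 1 ≤ n → n ≤ nScales β + 1 → IsKLRegime U cc (-(n : ℤ)) → HistP klPredsV17F2 L M G P Q R β U μ 0 n →
        (∀ m', 1 ≤ m' → m' < n → FlowPieceOscAt L M c'' β U μ m') →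
        ∀ J j : ℕ, 1 ≤ J → J ≤ n → J ≤ j → ∀ T : HubbardGrassmann L M,
        (∀ (m' : ℕ) (X : Fin m' → HubbardFieldIdx L M), ∑ i, signedMomentum L (X i).2 (X i).1.1.2 ≠ 0 → kernel ℂ T m' X = 0) →
        ∀ (q : Fin 2) (y : SpaceTimeIdx L M) (ℓ : SectorLeg (sectorCount J)) (Sw : ℝ), 0 ≤ Sw →
        (∀ (τ' : Fin 2 → SectorLeg 1) (y' : SpaceTimeIdx L M),
          imagTimeWeight β M ^ 1 * ∑ x' ∈ univ.filter (fun x' : Fin 2 → SpaceTimeIdx L M => x' q = y'),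
            klScaleWt L M β j ((univ.image x').image (fun x : SpaceTimeIdx L M => (((((2 * (x.1 : ℕ) : ℕ)) : ZMod (2 * (2 * M)))), x.2))) *
              ‖sectorisedKernel L M β (trivialMultiplier L M) T 2 τ' x'‖ ≤ Sw) →
        klWtPinnedSumAt L M β μ (klFlowFrameU L M β U μ n) J j 2 T q (y, ℓ) ≤ klThinCount2C * (CW ^ 2 * Sw) := by
  obtain ⟨CW, hCW, h⟩ := klWtPinnedSumAt_le_of_wplain_flow_all 1 R c'' hc''
  refine ⟨CW, hCW, ?_⟩
  intro G P Q cc hR2 hcc hcc6 hccT μ hμ U hU hUle hUT hcU β hβmin hβc L M _ _ hL3 hM3 n hn1 hnN hreg hhist hosc J j hJ1 hJn hJj T hT q y ℓ Sw hSw hplain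
  have hRj : ∀ j', 0 ≤ R.Gfr j' := gfr_nonneg_of_wf2 hR2
  have hfr : FrameOK R U (nScales β) μ (klFlowFrameU L M β U μ n) := frameOK_klFlowFrameU_of_histP_le hR2 hn1 le_rfl hnN hhist
  exact h G P Q cc hR2 hcc hcc6 μ hμ U hU hUle hcU β hβmin hβc L M hL3 hM3 n hn1 hnN hreg hhist hosc J j hJ1 hJn hJj T hT q y ℓ _ Sw hSw
    (card_bgmSectorSet_klAniso_two_anchored_le_doors hRj hcc hccT hU hUT hβmin hβc hμ μ hfr L M J q ℓ) hplain

/-- **THE WEIGHTED FOUR-LEG ONE-ANCHOR SIZE FROM THE WEIGHTED PLAIN LINE** (`N_c = klThinCountC·sectorCount J`, doors `cc ≤ klThinCountC₃ R`, `U ≤ klThinCountU₀ R`):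
`∃ CW > 0`, binders of §2 at `m + 1 = 4` plus the thin-count doors ⇒ `klWtPinnedSumAt … J j 4 T q (y, ℓ) ≤ klThinCountC·sectorCount J·CW⁴·Sʷ` — the one-anchor
count's `sectorCount J = 2^{J+1}` is the `2^{j}` of `klWtBudget … j 4` (at `J = j`). [cite: BenfattoGiulianiMastropietro2006, §2.8 (2.76)-(2.77), (2.96)] -/
theorem klWtPinnedSumAt_four_le_of_wplain_flow_all (R : RenConsts) (c'' : ℝ) (hc'' : 0 ≤ c'') :
    ∃ CW : ℝ, 0 < CW ∧
      ∀ (G : GeoConsts) (P : SplitConsts) (Q : EngConsts) (cc : ℝ), R.WF2 → 0 < cc → cc ≤ klEngC₃6 P R → cc ≤ klThinCountC₃ R →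
      ∀ μ ∈ klWindowC, ∀ U : ℝ, 0 < U → U ≤ min (klEngU₀3 P R cc) (1 / (R.Gfr 3 + 1)) → U ≤ klThinCountU₀ R → c'' * U ≤ 1 →
      ∀ β : ℝ, klBetaMin ≤ β → β ≤ Real.exp (cc / U ^ 2) →
      ∀ (L M : ℕ) [NeZero L] [NeZero M], klEngL₃ β U ≤ L → klEngM₃ β U L ≤ M →
      ∀ n : ℕ, 1 ≤ n → n ≤ nScales β + 1 → IsKLRegime U cc (-(n : ℤ)) → HistP klPredsV17F2 L M G P Q R β U μ 0 n →
        (∀ m', 1 ≤ m' → m' < n → FlowPieceOscAt L M c'' β U μ m') →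
        ∀ J j : ℕ, 1 ≤ J → J ≤ n → J ≤ j → ∀ T : HubbardGrassmann L M,
        (∀ (m' : ℕ) (X : Fin m' → HubbardFieldIdx L M), ∑ i, signedMomentum L (X i).2 (X i).1.1.2 ≠ 0 → kernel ℂ T m' X = 0) →
        ∀ (q : Fin 4) (y : SpaceTimeIdx L M) (ℓ : SectorLeg (sectorCount J)) (Sw : ℝ), 0 ≤ Sw →
        (∀ (τ' : Fin 4 → SectorLeg 1) (y' : SpaceTimeIdx L M),
          imagTimeWeight β M ^ 3 * ∑ x' ∈ univ.filter (fun x' : Fin 4 → SpaceTimeIdx L M => x' q = y'),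
            klScaleWt L M β j ((univ.image x').image (fun x : SpaceTimeIdx L M => (((((2 * (x.1 : ℕ) : ℕ)) : ZMod (2 * (2 * M)))), x.2))) *
              ‖sectorisedKernel L M β (trivialMultiplier L M) T 4 τ' x'‖ ≤ Sw) →
        klWtPinnedSumAt L M β μ (klFlowFrameU L M β U μ n) J j 4 T q (y, ℓ) ≤ klThinCountC * sectorCount J * (CW ^ 4 * Sw) := by
  obtain ⟨CW, hCW, h⟩ := klWtPinnedSumAt_le_of_wplain_flow_all 3 R c'' hc''
  refine ⟨CW, hCW, ?_⟩
  intro G P Q cc hR2 hcc hcc6 hccT μ hμ U hU hUle hUT hcU β hβmin hβc L M _ _ hL3 hM3 n hn1 hnN hreg hhist hosc J j hJ1 hJn hJj T hT q y ℓ Sw hSw hplain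
  have hRj : ∀ j', 0 ≤ R.Gfr j' := gfr_nonneg_of_wf2 hR2
  have hfr : FrameOK R U (nScales β) μ (klFlowFrameU L M β U μ n) := frameOK_klFlowFrameU_of_histP_le hR2 hn1 le_rfl hnN hhist
  exact h G P Q cc hR2 hcc hcc6 μ hμ U hU hUle hcU β hβmin hβc L M hL3 hM3 n hn1 hnN hreg hhist hosc J j hJ1 hJn hJj T hT q y ℓ _ Sw hSw
    (card_bgmSectorSet_klAniso_anchored_le_doors hRj hcc hccT hU hUT hβmin hβc hμ μ hfr L M J q ℓ) hplain

/-- **THE WEIGHTED SIX-LEG ONE-ANCHOR SIZE FROM THE WEIGHTED PLAIN LINE** (`N_c = klThinCount6C·|SectorLeg (sectorCount J)|⁴`, doors `cc ≤ klThinCount6C₃ R`,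
`U ≤ klThinCount6U₀ R`): `∃ CW > 0`, binders of §2 at `m + 1 = 6` plus the six-count doors ⇒
`klWtPinnedSumAt … J j 6 T q (y, ℓ) ≤ klThinCount6C·|SectorLeg (sectorCount J)|⁴·CW⁶·Sʷ` (`|SectorLeg (sectorCount J)|⁴ = 4096·2^{4J}` = the `2^{4j}` of
`klWtBudget … j 6` at `J = j`). [cite: BenfattoGiulianiMastropietro2006, §2.8 (2.76)-(2.77), (2.96)] -/
theorem klWtPinnedSumAt_six_le_of_wplain_flow_all (R : RenConsts) (c'' : ℝ) (hc'' : 0 ≤ c'') :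
    ∃ CW : ℝ, 0 < CW ∧
      ∀ (G : GeoConsts) (P : SplitConsts) (Q : EngConsts) (cc : ℝ), R.WF2 → 0 < cc → cc ≤ klEngC₃6 P R → cc ≤ klThinCount6C₃ R →
      ∀ μ ∈ klWindowC, ∀ U : ℝ, 0 < U → U ≤ min (klEngU₀3 P R cc) (1 / (R.Gfr 3 + 1)) → U ≤ klThinCount6U₀ R → c'' * U ≤ 1 →
      ∀ β : ℝ, klBetaMin ≤ β → β ≤ Real.exp (cc / U ^ 2) →
      ∀ (L M : ℕ) [NeZero L] [NeZero M], klEngL₃ β U ≤ L → klEngM₃ β U L ≤ M →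
      ∀ n : ℕ, 1 ≤ n → n ≤ nScales β + 1 → IsKLRegime U cc (-(n : ℤ)) → HistP klPredsV17F2 L M G P Q R β U μ 0 n →
        (∀ m', 1 ≤ m' → m' < n → FlowPieceOscAt L M c'' β U μ m') →
        ∀ J j : ℕ, 1 ≤ J → J ≤ n → J ≤ j → ∀ T : HubbardGrassmann L M,
        (∀ (m' : ℕ) (X : Fin m' → HubbardFieldIdx L M), ∑ i, signedMomentum L (X i).2 (X i).1.1.2 ≠ 0 → kernel ℂ T m' X = 0) →
        ∀ (q : Fin 6) (y : SpaceTimeIdx L M) (ℓ : SectorLeg (sectorCount J)) (Sw : ℝ), 0 ≤ Sw →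
        (∀ (τ' : Fin 6 → SectorLeg 1) (y' : SpaceTimeIdx L M),
          imagTimeWeight β M ^ 5 * ∑ x' ∈ univ.filter (fun x' : Fin 6 → SpaceTimeIdx L M => x' q = y'),
            klScaleWt L M β j ((univ.image x').image (fun x : SpaceTimeIdx L M => (((((2 * (x.1 : ℕ) : ℕ)) : ZMod (2 * (2 * M)))), x.2))) *
              ‖sectorisedKernel L M β (trivialMultiplier L M) T 6 τ' x'‖ ≤ Sw) →
        klWtPinnedSumAt L M β μ (klFlowFrameU L M β U μ n) J j 6 T q (y, ℓ) ≤
          klThinCount6C * (Fintype.card (SectorLeg (sectorCount J)) : ℝ) ^ 4 * (CW ^ 6 * Sw) := by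
  obtain ⟨CW, hCW, h⟩ := klWtPinnedSumAt_le_of_wplain_flow_all 5 R c'' hc''
  refine ⟨CW, hCW, ?_⟩
  intro G P Q cc hR2 hcc hcc6 hccT μ hμ U hU hUle hUT hcU β hβmin hβc L M _ _ hL3 hM3 n hn1 hnN hreg hhist hosc J j hJ1 hJn hJj T hT q y ℓ Sw hSw hplain
  have hRj : ∀ j', 0 ≤ R.Gfr j' := gfr_nonneg_of_wf2 hR2
  have hfr : FrameOK R U (nScales β) μ (klFlowFrameU L M β U μ n) := frameOK_klFlowFrameU_of_histP_le hR2 hn1 le_rfl hnN hhist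
  exact h G P Q cc hR2 hcc hcc6 μ hμ U hU hUle hcU β hβmin hβc L M hL3 hM3 n hn1 hnN hreg hhist hosc J j hJ1 hJn hJj T hT q y ℓ _ Sw hSw
    (card_bgmSectorSet_klAniso_six_anchored_le_doors hRj hcc hccT hU hUT hβmin hβc hμ μ hfr L M J q ℓ) hplain

end Summit.HubbardSuperconductivity.HubbardSuperconductivity.Theorems.EngineV8

end
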